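import Summits.ResolutionOfSingularities.ResolutionOfSingularities.Theorems.PurelyInseparableDim4Equimultiple
import Summits.ResolutionOfSingularities.ResolutionOfSingularities.Theorems.PurelyInseparableDim4ChartDictionary
import Literature.AlgebraicGeometry.Resolution.AffineCoordinateBlowupCharts
import Literature.AlgebraicGeometry.Hironaka2017.Lib.DiffPowerCoordArrangement
import Literature.AlgebraicGeometry.Hironaka2017.Lib.SpecOrdersDiff
import HarnessLib

/-!
# Purely inseparable four-folds `z^p + F(x₁, …, x₄)`: the cell's permissibility IS BGMW's admissibility
# condition (1) «centre ⊆ supp(𝓘, p)» for coordinate centres (brick TY-2 (e) of cell `res-dim4-pi`)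

[OURS · counted 0] (D-0157 DOOR 2; director-resolution DR-157-C; the S3 dictionary of desk row TY-2,
admissibility part). For the marked ideal `M = (𝔸⁵_K, (z^p + F)·𝒪, E, p)` of the target frame
(`PIDim4.hypSheaf`, `PIDim4.OrderReduction`) and a coordinate centre `V(z, x_S)`
(`AffineCoordBlowup.CΛ / 𝓘Λ 4 K Λ_S`, `Λ_S = insert 0 (Fin.succ '' S)`), a blow-up is a step of a marked
resolution (`IsMultipleBlowup.blowup`, BGMW Def. 3.1.3 (1)) only if `V(z, x_S) ⊆ supp M = {x | ord_x 𝓘 ≥ p}`.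
The cell's combinatorial permissibility is `PIDim4.IsPermissibleCentre p S F` = `S ≠ ∅ ∧ p ≤ ord_{(x_S)} F`
(`CentreBlowup.ordAlong`, Hauser–Perlega §2 condition (1)). PROVED here (no `sorry`, no new axiom):

* `sdeg_coe_eq_degIn`, `sdeg_centreVars_mapDomain_succ` — the `S`-degree of the HIRONAKA-L library
  (`SpanXValuation.sdeg`) is the tree's `CentreBlowup.degIn` (bridge, so that the library's
  «`f ∈ 𝔭_S^b ⟺ every monomial has S-degree ≥ b`» applies to `ordAlong`);
* `mem_pow_span_X_of_le_ordAlong`, `hyp_mem_IΛ_pow` — `p ≤ ord_{(x_S)} F ⇒ z^p + F ∈ I_Λ^p`,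
  `I_Λ = (z, xᵢ : i ∈ S)`;
* **`le_idealOrder_hypSheaf_of_mem_CΛ`, `CΛ_subset_support`, `support_𝓘Λ_subset_support`** —
  `p ≤ ord_{(x_S)} F ⇒ ord_x ((z^p + F)·𝒪) ≥ p` at EVERY scheme point `x` of `V(z, x_S)`, i.e.
  `V(z, x_S) ⊆ supp M` in exactly the shape `(C.support : Set X) ⊆ M.support` consumed by
  `IsMultipleBlowup.blowup / .single`;
* **`le_ordAlong_of_CΛ_subset_support`, `isPermissibleCentre_iff_CΛ_subset_support`** — the
  converse at the generic point of the centre (the library's saturation `sdeg_ge_of_mul_mem_pow`: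
  `I_Λ^{(p)} = I_Λ^p` for a coordinate prime): for `p ≠ 0`,
  `IsPermissibleCentre p S F ↔ S.Nonempty ∧ V(z, x_S) ⊆ supp M`.

So the cell's MODE 0 / 1h / 2 centres are exactly the coordinate centres through `z = 0` that are
admissible for the marked ideal in BGMW's sense (1); regularity of the centre and simple normal
crossings with the boundary (BGMW (2)) are separate bricks. Nothing here is a statement about resolution
of singularities in dimension ≥ 4 / characteristic `p` (NOT proved anywhere in this programme).
bears_on: LADDER-RESOLUTION:D157-DOOR2 (res-dim4-pi). Supports stmt-ResolutionOfSingularities-16155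
(helper, TY-2 (e)).
-/

-- every declaration of this summit lives under `Summit.ResolutionOfSingularities.ResolutionOfSingularities`
-- (summit = problem), which the duplicate-namespace linter flags; house convention (cf. the Target file).
set_option linter.dupNamespace false

noncomputable section

open MvPolynomial Finset CategoryTheory AlgebraicGeometry Opposite

namespace Summit.ResolutionOfSingularities.ResolutionOfSingularities.Theorems.PIDim4

open Literature.AlgebraicGeometry.Resolution
open Literature.AlgebraicGeometry.Resolution.AffinePointBlowup (P A γ coord Wtop)
open Literature.AlgebraicGeometry.Hironaka2017.SpecOrders
open Literature.AlgebraicGeometry.Hironaka2017.SpanXValuation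
open Literature.AlgebraicGeometry.Hironaka2017.CoordArrangement

namespace ChartDictionary

/-! ## §1 The library's `S`-degree is the tree's `degIn` -/

section Degrees

variable {σ : Type*}

/-- The HIRONAKA-L library's `S`-degree `sdeg ↑S d = Σᵢ dᵢ · 𝟙_S(i)` is the tree's
`CentreBlowup.degIn S d = Σ_{i ∈ S} dᵢ`. -/
theorem sdeg_coe_eq_degIn (S : Finset σ) (d : σ →₀ ℕ) :
    sdeg (S : Set σ) d = CentreBlowup.degIn S d := by
  classical
  rw [sdeg, Finsupp.weight_apply, Finsupp.sum, CentreBlowup.degIn]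
  rw [← Finset.sum_filter_add_sum_filter_not d.support (· ∈ S)]
  have h2 : ∑ i ∈ d.support.filter (fun i => ¬ i ∈ S), d i • indWeight (S : Set σ) i = 0 :=
    Finset.sum_eq_zero fun i hi => by
      rw [indWeight_of_not_mem (show i ∉ (S : Set σ) from fun h => (Finset.mem_filter.mp hi).2 h),
        smul_zero]
  have h1 : ∑ i ∈ d.support.filter (· ∈ S), d i • indWeight (S : Set σ) i =
      ∑ i ∈ d.support.filter (· ∈ S), d i :=
    Finset.sum_congr rfl fun i hi => by
      rw [indWeight_of_mem (show i ∈ (S : Set σ) from (Finset.mem_filter.mp hi).2), smul_eq_mul, mul_one]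
  rw [h2, add_zero, h1]
  refine Finset.sum_subset (fun i hi => (Finset.mem_filter.mp hi).2) fun i hiS hin => ?_
  by_contra hne
  exact hin (Finset.mem_filter.mpr ⟨Finsupp.mem_support_iff.mpr hne, hiS⟩)

/-- In the variables of `𝔸⁵` (`z = X 0`, `xᵢ = X i.succ`): the `Λ_S`-degree of the exponent of `x^d`
(no `z`) is `Σ_{i ∈ S} dᵢ`. -/
theorem sdeg_centreVars_mapDomain_succ (S : Finset (Fin 4)) (d : Fin 4 →₀ ℕ) :
    sdeg (insert 0 (Fin.succ '' (S : Set (Fin 4))) : Set (Fin (4 + 1))) (d.mapDomain Fin.succ) =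
      CentreBlowup.degIn S d := by
  rw [← sdeg_coe_eq_degIn, sdeg, sdeg, Finsupp.weight_apply, Finsupp.weight_apply,
    Finsupp.sum_mapDomain_index_inj (Fin.succ_injective 4)]
  refine Finsupp.sum_congr fun i _ => ?_
  by_cases hi : i ∈ S
  · rw [indWeight_of_mem (succ_mem_centreVars hi), indWeight_of_mem (show i ∈ (S : Set (Fin 4)) from hi)]
  · rw [indWeight_of_not_mem (fun h => hi ((succ_mem_centreVars_iff S i).mp h)),
      indWeight_of_not_mem (show i ∉ (S : Set (Fin 4)) from hi)]

end Degrees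

/-! ## §2 `p ≤ ord_{(x_S)} F` puts `z^p + F` in `I_Λ^p` -/

section Ideals

variable {K : Type} [Field K]

/-- **`q ≤ ord_{(x_S)} F ⇒ F ∈ (xᵢ : i ∈ S)^q`** in `K[x₁, …, x₄]` (every monomial of `F` has
`S`-degree `≥ q`; the library's `mem_pow_span_X_of_support`). -/
theorem mem_pow_span_X_of_le_ordAlong (q : ℕ) (S : Finset (Fin 4)) (F : MvPolynomial (Fin 4) K)
    (hperm : (q : ℕ∞) ≤ CentreBlowup.ordAlong S F) :
    F ∈ Ideal.span (X '' (S : Set (Fin 4)) : Set (MvPolynomial (Fin 4) K)) ^ q := by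
  refine mem_pow_span_X_of_support fun m hm => ?_
  rw [sdeg_coe_eq_degIn]
  have h : CentreBlowup.ordAlong S F ≤ (CentreBlowup.degIn S m : ℕ∞) := Finset.inf_le hm
  exact_mod_cast hperm.trans h

/-- Hence `F(x) ∈ I_Λ^q` in `K[z, x]`, `I_Λ = (z, xᵢ : i ∈ S)` (`AffineCoordBlowup.IΛ`). -/
theorem rename_mem_IΛ_pow (q : ℕ) (S : Finset (Fin 4)) (F : MvPolynomial (Fin 4) K)
    (hperm : (q : ℕ∞) ≤ CentreBlowup.ordAlong S F) :
    rename Fin.succ F ∈ AffineCoordBlowup.IΛ 4 K (insert 0 (Fin.succ '' (S : Set (Fin 4)))) ^ q := by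
  have h1 : rename Fin.succ F ∈
      (Ideal.span (X '' (S : Set (Fin 4)) : Set (MvPolynomial (Fin 4) K)) ^ q).map (rename Fin.succ) :=
    Ideal.mem_map_of_mem _ (mem_pow_span_X_of_le_ordAlong q S F hperm)
  rw [Ideal.map_pow, Ideal.map_span, Set.image_image] at h1
  refine Ideal.pow_right_mono (Ideal.span_mono ?_) q h1
  rintro _ ⟨i, hi, rfl⟩
  exact ⟨i.succ, succ_mem_centreVars (Finset.mem_coe.mp hi), (rename_X _ i).symm⟩

/-- **`q ≤ ord_{(x_S)} F ⇒ z^q + F ∈ I_Λ^q`.** -/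
theorem hyp_mem_IΛ_pow (q : ℕ) (S : Finset (Fin 4)) (F : MvPolynomial (Fin 4) K)
    (hperm : (q : ℕ∞) ≤ CentreBlowup.ordAlong S F) :
    hyp q F ∈ AffineCoordBlowup.IΛ 4 K (insert 0 (Fin.succ '' (S : Set (Fin 4)))) ^ q := by
  rw [hyp]
  exact Ideal.add_mem _
    (Ideal.pow_mem_pow (Ideal.subset_span (Set.mem_image_of_mem X (zero_mem_centreVars S))) q)
    (rename_mem_IΛ_pow q S F hperm)

/-! ## §3 `V(z, x_S) ⊆ supp(𝔸⁵, (z^p + F)·𝒪, E, p)` -/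

/-- **Order `≥ q` along the centre, at EVERY scheme point of it**: if `q ≤ ord_{(x_S)} F` then
`q ≤ ord_x ((z^q + F)·𝒪)` for every `x ∈ V(z, x_S)` (closed or not): `z^q + F ∈ I_Λ^q ⊆ 𝔓_x^q`. -/
theorem le_idealOrder_hypSheaf_of_mem_CΛ (q : ℕ) (S : Finset (Fin 4)) (F : MvPolynomial (Fin 4) K)
    (hperm : (q : ℕ∞) ≤ CentreBlowup.ordAlong S F) {x : P 4 K}
    (hx : x ∈ AffineCoordBlowup.CΛ 4 K (insert 0 (Fin.succ '' (S : Set (Fin 4))))) :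
    (q : ℕ∞) ≤ idealOrder (hypSheaf q F) x := by
  rw [Equimultiple.hypSheaf_eq_shf]
  refine le_idealOrder_shf_of_le_pow (A 4 K) _ x q ?_
  rw [Ideal.span_le, Set.singleton_subset_iff]
  exact Ideal.pow_right_mono ((AffineCoordBlowup.mem_CΛ_iff 4 K _ x).mp hx) q
    (hyp_mem_IΛ_pow q S F hperm)

/-- **The centre lies in the support of the marked ideal**: `q ≤ ord_{(x_S)} F ⇒
V(z, x_S) ⊆ supp(𝔸⁵_K, (z^q + F)·𝒪, E, q)` (`MarkedIdeal.support = {x | q ≤ ord_x}`), any boundary `E`. -/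
theorem CΛ_subset_support (q : ℕ) (S : Finset (Fin 4)) (F : MvPolynomial (Fin 4) K)
    (hperm : (q : ℕ∞) ≤ CentreBlowup.ordAlong S F) (E : List (P 4 K).IdealSheafData) :
    (AffineCoordBlowup.CΛ 4 K (insert 0 (Fin.succ '' (S : Set (Fin 4)))) : Set (P 4 K)) ⊆
      (⟨hypSheaf q F, E, q⟩ : MarkedIdeal (P 4 K)).support :=
  fun _ hx => le_idealOrder_hypSheaf_of_mem_CΛ q S F hperm hx

/-- The same in the shape consumed by `IsMultipleBlowup.blowup / .single` (BGMW Def. 3.1.3 (1)):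
`(𝓘Λ.support : Set) ⊆ M.support`. -/
theorem support_𝓘Λ_subset_support (q : ℕ) (S : Finset (Fin 4)) (F : MvPolynomial (Fin 4) K)
    (hperm : (q : ℕ∞) ≤ CentreBlowup.ordAlong S F) (E : List (P 4 K).IdealSheafData) :
    ((AffineCoordBlowup.𝓘Λ 4 K (insert 0 (Fin.succ '' (S : Set (Fin 4))))).support : Set (P 4 K)) ⊆
      (⟨hypSheaf q F, E, q⟩ : MarkedIdeal (P 4 K)).support := by
  rw [AffineCoordBlowup.support_𝓘Λ]
  exact CΛ_subset_support q S F hperm E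

/-- The cell's predicate: `PIDim4.IsPermissibleCentre q S F ⇒ V(z, x_S) ⊆ supp M`. -/
theorem support_𝓘Λ_subset_support_of_isPermissibleCentre (q : ℕ) {S : Finset (Fin 4)}
    {F : MvPolynomial (Fin 4) K} (hS : IsPermissibleCentre q S F) (E : List (P 4 K).IdealSheafData) :
    ((AffineCoordBlowup.𝓘Λ 4 K (insert 0 (Fin.succ '' (S : Set (Fin 4))))).support : Set (P 4 K)) ⊆
      (⟨hypSheaf q F, E, q⟩ : MarkedIdeal (P 4 K)).support :=
  support_𝓘Λ_subset_support q S F hS.2 E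

/-! ## §4 The converse at the generic point of the centre -/

/-- The generic point of `V(z, x_S)`: the prime `I_Λ` itself. -/
theorem IΛ_mem_CΛ (S : Finset (Fin 4)) :
    (⟨AffineCoordBlowup.IΛ 4 K (insert 0 (Fin.succ '' (S : Set (Fin 4)))),
        AffineCoordBlowup.isPrime_IΛ 4 K _⟩ : P 4 K) ∈
      AffineCoordBlowup.CΛ 4 K (insert 0 (Fin.succ '' (S : Set (Fin 4)))) :=
  (AffineCoordBlowup.mem_CΛ_iff 4 K _ _).mpr le_rfl

/-- A monomial `x^d` of `F` is a monomial of `z^q + F` (`q ≠ 0`): its exponent, moved to the variables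
`x = X ∘ Fin.succ`, is not the exponent of `z^q`. -/
theorem coeff_mapDomain_succ_hyp {q : ℕ} (hq : q ≠ 0) (F : MvPolynomial (Fin 4) K) (d : Fin 4 →₀ ℕ) :
    coeff (d.mapDomain Fin.succ) (hyp q F) = coeff d F := by
  rw [hyp, coeff_add, coeff_X_pow, if_neg, zero_add, coeff_rename_mapDomain _ (Fin.succ_injective 4)]
  intro h
  have h0 := DFunLike.congr_fun h 0
  rw [Finsupp.single_eq_same, Finsupp.mapDomain_notin_range] at h0
  · exact hq h0
  · rintro ⟨i, hi⟩
    exact Fin.succ_ne_zero i hi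

/-- **Converse (saturation at the generic point)**: if `ord_x ((z^q + F)·𝒪) ≥ q` at the generic point
`x = I_Λ` of `V(z, x_S)` and `q ≠ 0`, then `q ≤ ord_{(x_S)} F` — `I_Λ^{(q)} = I_Λ^q` for the coordinate
prime `I_Λ` (the library's `sdeg_ge_of_mul_mem_pow`), so every monomial of `z^q + F`, in particular every
`x^d` of `F`, has `Λ_S`-degree `≥ q`. -/
theorem le_ordAlong_of_le_idealOrder_generic {q : ℕ} (hq : q ≠ 0) (S : Finset (Fin 4))
    (F : MvPolynomial (Fin 4) K)
    (h : (q : ℕ∞) ≤ idealOrder (hypSheaf q F)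
      (⟨AffineCoordBlowup.IΛ 4 K (insert 0 (Fin.succ '' (S : Set (Fin 4)))),
        AffineCoordBlowup.isPrime_IΛ 4 K _⟩ : P 4 K)) :
    (q : ℕ∞) ≤ CentreBlowup.ordAlong S F := by
  rw [Equimultiple.hypSheaf_eq_shf, le_idealOrder_shf_span_singleton_iff] at h
  obtain ⟨s, hs, hsf⟩ := h
  have hmon := sdeg_ge_of_mul_mem_pow hs hsf
  refine CentreBlowup.le_ordAlong_of_forall fun d hd => ?_
  have hd' : d.mapDomain Fin.succ ∈ (hyp q F).support := by
    rw [MvPolynomial.mem_support_iff, coeff_mapDomain_succ_hyp hq]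
    exact MvPolynomial.mem_support_iff.mp hd
  have h1 := hmon _ hd'
  rwa [sdeg_centreVars_mapDomain_succ] at h1

/-- **Converse, support form**: `V(z, x_S) ⊆ supp(𝔸⁵, (z^q + F)·𝒪, E, q)` with `q ≠ 0` forces
`q ≤ ord_{(x_S)} F`. -/
theorem le_ordAlong_of_CΛ_subset_support {q : ℕ} (hq : q ≠ 0) (S : Finset (Fin 4))
    (F : MvPolynomial (Fin 4) K) (E : List (P 4 K).IdealSheafData)
    (h : (AffineCoordBlowup.CΛ 4 K (insert 0 (Fin.succ '' (S : Set (Fin 4)))) : Set (P 4 K)) ⊆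
      (⟨hypSheaf q F, E, q⟩ : MarkedIdeal (P 4 K)).support) :
    (q : ℕ∞) ≤ CentreBlowup.ordAlong S F :=
  le_ordAlong_of_le_idealOrder_generic hq S F (h (IΛ_mem_CΛ S))

/-- **THE PERMISSIBILITY DICTIONARY.** For `q ≠ 0` (e.g. `q = p` prime) the cell's Hironaka-permissibility
of the coordinate centre `V(z, x_S)` for `z^q + F` (`PIDim4.IsPermissibleCentre q S F`: `S ≠ ∅` and
`q ≤ ord_{(x_S)} F`) is EQUIVALENT to `S ≠ ∅` together with BGMW's admissibility condition (1)
«centre ⊆ supp(𝓘, q)» for the marked ideal `(𝔸⁵_K, (z^q + F)·𝒪, E, q)` — for every boundary `E`. -/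
theorem isPermissibleCentre_iff_CΛ_subset_support {q : ℕ} (hq : q ≠ 0) (S : Finset (Fin 4))
    (F : MvPolynomial (Fin 4) K) (E : List (P 4 K).IdealSheafData) :
    IsPermissibleCentre q S F ↔ S.Nonempty ∧
      (AffineCoordBlowup.CΛ 4 K (insert 0 (Fin.succ '' (S : Set (Fin 4)))) : Set (P 4 K)) ⊆
        (⟨hypSheaf q F, E, q⟩ : MarkedIdeal (P 4 K)).support :=
  ⟨fun h => ⟨h.1, CΛ_subset_support q S F h.2 E⟩,
    fun h => ⟨h.1, le_ordAlong_of_CΛ_subset_support hq S F E h.2⟩⟩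

end Ideals

end ChartDictionary

end Summit.ResolutionOfSingularities.ResolutionOfSingularities.Theorems.PIDim4

end
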